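import Summits.HodgeConjecture.HodgeConjecture.Theorems.R90S6TorusFixedSpecialCount          -- ★ W8-i′ FILE 1 `natCard_fixedBy_special_add_eq_one_add_sum` (a₁ + a₀ = 1 + Σ_x s(x))
import Summits.HodgeConjecture.HodgeConjecture.Theorems.R90S6ResidualStarFixedPoints        -- ★ W8-i″ FILE 2 `natCard_fixedBy_star_eq_ncard_fixed_neighborSet_root` (s(x) = fixed star count)
import Summits.HodgeConjecture.HodgeConjecture.Theorems.R90S6ResidualStarFixedPlaneScalar   -- ★ 3c-A `ncard_fixed_neighborSet_root_eq_residualIso_of_residually_plane_scalar` (↦ q + 1)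
import Summits.HodgeConjecture.HodgeConjecture.Theorems.R90S6ResidualStarFixedPlaneUnipotent -- ★ 3c-B `ncard_fixed_neighborSet_root_eq_one_of_residually_plane_unipotent` (↦ 1)
import Literature.NumberTheory.Automorphic.UnitaryFixedCosetsStableLattices                  -- ★ `unitaryInt_eq_glInt_subgroupOf`
import HarnessLib

/-!
# R90 · S6 «Ch. 14.1–14.5 stable trace formula» — LINE S1 «special fixed counts per regime», REGIME R-II RUNG 1′: `a₁ = 1 + q·m` FOR A TORUS ELEMENT RESIDUALLY CONGRUENT TO
# `diag(c₁, c₁, c₂)`, `c̄₁ ≠ c̄₂`, IN FRAME CURRENCY (`Theorems/R90S6TorusFixedSpecialCountTwoCongruent.lean`)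

Cell `hodgecm-mathlib`, crux H413 (`stmt-HodgeConjecture-24833`), route of record `HCCMUnconditional`; programme R90-TF, section S6 (base `R90-C14`), seat R90-C14-p05 (g0);
S6 dealer R90-C14-plan (g2) 00:39:05Z (S1 taxonomy «=») ∕ 00:52:55Z «then R-II rung 1′ in the same frame currency» (DAG r5 row E1.3.5.2.4).  Helper lane
`--supports stmt-HodgeConjecture-24833 --as helper`; THEOREMS ONLY (no definition, no instance, no notation, no named fact, no `sorry`); the FILE-1 letters and the
`Finset.sum_ite` assembly are those of the sibling ★ `R90S6TorusFixedSpecialCountUnipotent` (R90-C14-p07 (g0), regime R-I).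

THE MATHEMATICS [Kottwitz1988, §2; Serre1980Trees, I.6 and II.1.1; Tits1979, §3.5; Rogawski1990, §4.9].  `γ ∈ U = U(σ,J₀)(K)` with finitely many fixed hyperspecial
vertices `x ∈ Fix_γ(U⧸K₀)`, local monodromies `k_x = r(x)⁻¹ γ r(x) ∈ K₀` (`r` a section).  ★ FILE 1: `a₁ + a₀ = 1 + Σ_x s(x)`, ★ FILE 2: `s(x)` = the number of `k_x`-fixed
vertices of the star of `L₀`.  REGIME R-II: at every fixed `x` an integral frame `P_x` is GIVEN in which `A = P⁻¹k_xP ≡ (c₁-block on ⟨p̄₀,p̄₁⟩) ⊕ (c₂ on ⟨p̄₂⟩)` mod `𝔪`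
(`|c₁ − c₂| = 1`, `p̄₂` anisotropic, `p̄₁` isotropic), the `c₁`-block being EITHER scalar (`|A₁₀| < 1`; then the plane pair is hyperbolic) OR a non-trivial unipotent
(`|A₁₀| = 1`).  Then `s(x) = q + 1` (★ 3c-A) or `1` (★ 3c-B), and the first alternative holds iff `(k_x − c₁)(k_x − c₂) ≡ 0 (mod 𝔪)` (conjugate by the frame; in the
second alternative the `(1,0)` entry `A₁₀(A₀₀ − c₂) + (A₁₁ − c₁)A₁₀ + A₁₂A₂₀` of `(A − c₁)(A − c₂)` is a unit) — an INTRINSIC predicate («`k_x` residually semisimple»).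
Summing, `a₁ + a₀ = 1 + (q+1)·m + (a₀ − m)`, i.e. **`a₁ = 1 + q·m`**, `m = #{x ∈ Fix_γ(U⧸K₀) : (k_x − c₁)(k_x − c₂) ≡ 0}`.  The frames exist for every `γ` with
`χ_γ ≡ (X − c₁)²(X − c₂)` (residual eigenspace splitting of the residually unitary `k̄_x`; junction with ★ `R90S6ResidualUnitaryReduction`), which is the later transport rung.
HONEST LABEL: a composition (★ FILE 1 ∘ ★ FILE 2 ∘ ★ 3c-A ∘ ★ 3c-B), unconditional in its own (frame) letters; count-neutral until the frame-transport rung and the closed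
form of `m` land; proves no printed statement.  HC_CM is proved only modulo the 7 printed citations (2 remaining named inputs: hLiu418 = stmt-HodgeConjecture-24832,
h413 = stmt-HodgeConjecture-24833) until rung 0 closes.
-/

set_option autoImplicit false
-- the mandated namespace repeats the single-problem summit's segment (`HodgeConjecture.HodgeConjecture`)
set_option linter.dupNamespace false

noncomputable section

open MulAction
open Literature.NumberTheory.Automorphic Literature.NumberTheory.Automorphic.HermitianLattice Literature.NumberTheory.Automorphic.UnitaryGroup
open Literature.NumberTheory.Automorphic.UnitaryLatticeTree
open scoped Matrix MatrixGroups WithZero Valued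

namespace Summit.HodgeConjecture.HodgeConjecture.R90.S6

variable {K : Type*} [Field K] [Valued K ℤᵐ⁰]

/-- **THE FRAME READS THE INTRINSIC PREDICATE.**  For an integral `k` and an integral frame `P` (`P⁻¹` integral) with `A = P⁻¹kP`, `|A₀₀ − c₁|, |A₁₁ − c₁|, |A₂₂ − c₂| < 1`,
`|c₁ − c₂| = 1`, and all off-diagonal entries of `A` other than `A₁₀` in `𝔪`: `(k − c₁)(k − c₂) ≡ 0 (mod 𝔪)` entrywise iff `|A₁₀| < 1` (conjugation by the frame; if
`|A₁₀| = 1` the `(1,0)` entry of `(A − c₁)(A − c₂)` is the unit `A₁₀(A₀₀ − c₂) + (A₁₁ − c₁)A₁₀ + A₁₂A₂₀`). [cite: Tits1979, §3.5] [cite: Serre1980Trees, II.1.1] -/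
theorem forall_v_sub_mul_sub_apply_lt_one_iff_of_frame {k : Matrix (Fin 3) (Fin 3) K} (hk : ∀ i j, Valued.v (k i j) ≤ 1)
    (P : GL (Fin 3) K) (hP : ∀ i j, Valued.v ((P : Matrix (Fin 3) (Fin 3) K) i j) ≤ 1) (hP' : ∀ i j, Valued.v (((P⁻¹ : GL (Fin 3) K) : Matrix (Fin 3) (Fin 3) K) i j) ≤ 1)
    {c₁ c₂ : K} (hc₁ : Valued.v c₁ = 1) (hsep : Valued.v (c₁ - c₂) = 1)
    (h00 : Valued.v ((((P⁻¹ : GL (Fin 3) K) : Matrix (Fin 3) (Fin 3) K) * k * (P : Matrix (Fin 3) (Fin 3) K)) 0 0 - c₁) < 1)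
    (h11 : Valued.v ((((P⁻¹ : GL (Fin 3) K) : Matrix (Fin 3) (Fin 3) K) * k * (P : Matrix (Fin 3) (Fin 3) K)) 1 1 - c₁) < 1)
    (h22 : Valued.v ((((P⁻¹ : GL (Fin 3) K) : Matrix (Fin 3) (Fin 3) K) * k * (P : Matrix (Fin 3) (Fin 3) K)) 2 2 - c₂) < 1)
    (hoff : ∀ i j : Fin 3, i ≠ j → (i, j) ≠ ((1 : Fin 3), (0 : Fin 3)) →
      Valued.v ((((P⁻¹ : GL (Fin 3) K) : Matrix (Fin 3) (Fin 3) K) * k * (P : Matrix (Fin 3) (Fin 3) K)) i j) < 1) :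
    (∀ i j, Valued.v (((k - c₁ • (1 : Matrix (Fin 3) (Fin 3) K)) * (k - c₂ • (1 : Matrix (Fin 3) (Fin 3) K))) i j) < 1) ↔
      Valued.v ((((P⁻¹ : GL (Fin 3) K) : Matrix (Fin 3) (Fin 3) K) * k * (P : Matrix (Fin 3) (Fin 3) K)) 1 0) < 1 := by
  set PM : Matrix (Fin 3) (Fin 3) K := (P : Matrix (Fin 3) (Fin 3) K) with hPM
  set QM : Matrix (Fin 3) (Fin 3) K := ((P⁻¹ : GL (Fin 3) K) : Matrix (Fin 3) (Fin 3) K) with hQM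
  set A : Matrix (Fin 3) (Fin 3) K := QM * k * PM with hA
  have hPQ : PM * QM = 1 := by rw [hPM, hQM, ← Units.val_mul, mul_inv_cancel, Units.val_one]
  have hQP : QM * PM = 1 := by rw [hPM, hQM, ← Units.val_mul, inv_mul_cancel, Units.val_one]
  have hm1 : ∀ a b : ℤᵐ⁰, a ≤ 1 → b < 1 → a * b < 1 := fun a b ha hb => by rw [mul_comm]; exact mul_lt_one_of_lt_of_le hb ha
  -- integrality bookkeeping
  have hmulint : ∀ X Y : Matrix (Fin 3) (Fin 3) K, (∀ i j, Valued.v (X i j) ≤ 1) → (∀ i j, Valued.v (Y i j) ≤ 1) → ∀ i j, Valued.v ((X * Y) i j) ≤ 1 := by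
    intro X Y hX hY i j
    rw [Matrix.mul_apply]
    refine Valuation.map_sum_le _ fun a _ => ?_
    rw [map_mul]; exact mul_le_one' (hX i a) (hY a j)
  have hAint : ∀ i j, Valued.v (A i j) ≤ 1 := hmulint _ _ (hmulint _ _ hP' hk) hP
  have hc₂ : Valued.v c₂ ≤ 1 := by
    have e : c₂ = c₁ - (c₁ - c₂) := by ring
    rw [e]; exact (Valuation.map_sub _ _ _).trans (max_le hc₁.le hsep.le)
  have hsubint : ∀ (X : Matrix (Fin 3) (Fin 3) K) (c : K), (∀ i j, Valued.v (X i j) ≤ 1) → Valued.v c ≤ 1 →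
      ∀ i j, Valued.v ((X - c • (1 : Matrix (Fin 3) (Fin 3) K)) i j) ≤ 1 := by
    intro X c hX hc i j
    rw [Matrix.sub_apply, Matrix.smul_apply, smul_eq_mul]
    refine (Valuation.map_sub _ _ _).trans (max_le (hX i j) ?_)
    rw [Matrix.one_apply]
    split_ifs
    · rw [mul_one]; exact hc
    · rw [mul_zero, map_zero]; exact zero_le_one
  -- small matrices stay small under integral two-sided multiplication
  have hsmall : ∀ X M Y : Matrix (Fin 3) (Fin 3) K, (∀ i j, Valued.v (X i j) ≤ 1) → (∀ i j, Valued.v (M i j) < 1) → (∀ i j, Valued.v (Y i j) ≤ 1) →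
      ∀ i j, Valued.v ((X * M * Y) i j) < 1 := by
    intro X M Y hX hM hY i j
    rw [Matrix.mul_apply]
    refine Valuation.map_sum_lt _ one_ne_zero fun a _ => ?_
    rw [map_mul]
    refine mul_lt_one_of_lt_of_le ?_ (hY a j)
    rw [Matrix.mul_apply]
    refine Valuation.map_sum_lt _ one_ne_zero fun b _ => ?_
    rw [map_mul]; exact hm1 _ _ (hX i b) (hM b a)
  -- conjugation identities
  have hconj : ∀ c : K, A - c • (1 : Matrix (Fin 3) (Fin 3) K) = QM * (k - c • 1) * PM := fun c => by
    rw [Matrix.mul_sub, Matrix.sub_mul, Matrix.mul_smul, Matrix.smul_mul, Matrix.mul_one, hQP, hA]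
  have hprodA : (A - c₁ • 1) * (A - c₂ • 1) = QM * ((k - c₁ • 1) * (k - c₂ • 1)) * PM := by
    rw [hconj, hconj]
    calc QM * (k - c₁ • 1) * PM * (QM * (k - c₂ • 1) * PM) = QM * (k - c₁ • 1) * (PM * QM) * (k - c₂ • 1) * PM := by
          simp only [Matrix.mul_assoc]
      _ = _ := by rw [hPQ, Matrix.mul_one, Matrix.mul_assoc QM]
  have hprodk : (k - c₁ • 1) * (k - c₂ • 1) = PM * ((A - c₁ • 1) * (A - c₂ • 1)) * QM := by
    rw [hprodA]
    calc (k - c₁ • 1) * (k - c₂ • 1) = (PM * QM) * ((k - c₁ • 1) * (k - c₂ • 1)) * (PM * QM) := by rw [hPQ, Matrix.one_mul, Matrix.mul_one]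
      _ = _ := by simp only [Matrix.mul_assoc]
  constructor
  · -- (⇒): if `|A₁₀| = 1` the `(1,0)` entry of `(A − c₁)(A − c₂) = P⁻¹[(k − c₁)(k − c₂)]P` would be a unit
    intro hks
    by_contra h10
    have h10' : Valued.v (A 1 0) = 1 := le_antisymm (hAint 1 0) (not_lt.1 h10)
    have hsm : Valued.v (((A - c₁ • 1) * (A - c₂ • 1)) 1 0) < 1 := by rw [hprodA]; exact hsmall _ _ _ hP' hks hP 1 0
    have hentry : ((A - c₁ • 1) * (A - c₂ • 1)) 1 0 = A 1 0 * (A 0 0 - c₂) + ((A 1 1 - c₁) * A 1 0 + A 1 2 * A 2 0) := by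
      rw [Matrix.mul_apply, Fin.sum_univ_three]
      simp only [Matrix.sub_apply, Matrix.smul_apply, Matrix.one_apply, smul_eq_mul]
      simp
      ring
    have hA0c₂ : Valued.v (A 0 0 - c₂) = 1 := by
      have e : A 0 0 - c₂ = (c₁ - c₂) + (A 0 0 - c₁) := by ring
      rw [e, Valuation.map_add_eq_of_lt_left _ (by rw [hsep]; exact h00), hsep]
    have hhead : Valued.v (A 1 0 * (A 0 0 - c₂)) = 1 := by rw [map_mul, h10', hA0c₂, one_mul]
    have htail : Valued.v ((A 1 1 - c₁) * A 1 0 + A 1 2 * A 2 0) < 1 := by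
      refine Valuation.map_add_lt _ ?_ ?_
      · rw [map_mul]; exact mul_lt_one_of_lt_of_le h11 (hAint 1 0)
      · rw [map_mul]; exact mul_lt_one_of_lt_of_le (hoff 1 2 (by decide) (by decide)) (hAint 2 0)
    have hv : Valued.v (((A - c₁ • 1) * (A - c₂ • 1)) 1 0) = 1 := by
      rw [hentry, Valuation.map_add_eq_of_lt_left _ (by rw [hhead]; exact htail), hhead]
    rw [hv] at hsm
    exact lt_irrefl _ hsm
  · -- (⇐): all of `(A − c₁)(A − c₂)` is in `𝔪`, hence so is `(k − c₁)(k − c₂) = P[(A − c₁)(A − c₂)]P⁻¹`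
    intro h10
    have hoff' : ∀ i j : Fin 3, i ≠ j → Valued.v (A i j) < 1 := by
      intro i j hij
      by_cases h : (i, j) = ((1 : Fin 3), (0 : Fin 3))
      · simp only [Prod.mk.injEq] at h
        rw [h.1, h.2]; exact h10
      · exact hoff i j hij h
    have hcol : ∀ i l : Fin 3, l ≠ 2 → Valued.v ((A - c₁ • (1 : Matrix (Fin 3) (Fin 3) K)) i l) < 1 := by
      intro i l hl
      rw [Matrix.sub_apply, Matrix.smul_apply, Matrix.one_apply, smul_eq_mul]
      by_cases hil : i = l
      · subst hil
        rw [if_pos rfl, mul_one]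
        fin_cases i
        exacts [h00, h11, absurd rfl hl]
      · rw [if_neg hil, mul_zero, sub_zero]; exact hoff' i l hil
    have hrow : ∀ j : Fin 3, Valued.v ((A - c₂ • (1 : Matrix (Fin 3) (Fin 3) K)) 2 j) < 1 := by
      intro j
      rw [Matrix.sub_apply, Matrix.smul_apply, Matrix.one_apply, smul_eq_mul]
      by_cases hj : (2 : Fin 3) = j
      · subst hj; rw [if_pos rfl, mul_one]; exact h22
      · rw [if_neg hj, mul_zero, sub_zero]; exact hoff' 2 j hj
    have hAA : ∀ i j, Valued.v (((A - c₁ • 1) * (A - c₂ • 1)) i j) < 1 := by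
      intro i j
      rw [Matrix.mul_apply]
      refine Valuation.map_sum_lt _ one_ne_zero fun l _ => ?_
      rw [map_mul]
      by_cases hl : l = 2
      · subst hl; exact hm1 _ _ (hsubint A c₁ hAint hc₁.le i 2) (hrow j)
      · exact mul_lt_one_of_lt_of_le (hcol i l hl) (hsubint A c₂ hAint hc₂ l j)
    intro i j
    rw [hprodk]; exact hsmall _ _ _ hP hAA hP' i j

-- the quotient-action instances `MulAction ↥K₀ (↥K₀ ⧸ I.subgroupOf K₀)` of ★ FILE 1 ∕ FILE 2 exceed the default synthesis budget (same bump as those ★ files)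
set_option synthInstance.maxHeartbeats 400000 in
set_option maxHeartbeats 1600000 in
/-- **R-II RUNG 1′ — `a₁ = 1 + q·m` IN FRAME CURRENCY.**  In ★ FILE 1's letters (`γ ∈ U`, section `r` of `U → U⧸K₀`, local monodromies `k_x = r(x)⁻¹γr(x)`, finitely
many fixed hyperspecial vertices, `|𝓀| = q²`, `σk = Frob_q`): if at every `x ∈ Fix_γ(U⧸K₀)` an integral frame `P` is given with `A = P⁻¹k_xP` residually
`(c₁-block on ⟨p̄₀,p̄₁⟩) ⊕ (c₂ on ⟨p̄₂⟩)` (`|c₁| = |c₁ − c₂| = 1`; `|A₀₀ − c₁|, |A₁₁ − c₁|, |A₂₂ − c₂| < 1`; off-diagonal entries other than `A₁₀` in `𝔪`; `p̄₂` anisotropic,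
`p̄₁` isotropic, and `⟨p̄₀,p̄₁⟩` a hyperbolic pair whenever `|A₁₀| < 1`), then the number `a₁` of `γ`-fixed special vertices is `1 + q·m`, `m` the number of fixed
hyperspecial `x` with `(k_x − c₁)(k_x − c₂) ≡ 0 (mod 𝔪)` (★ FILE 1 ∘ ★ FILE 2 ∘ ★ 3c-A ∘ ★ 3c-B ∘ `forall_v_sub_mul_sub_apply_lt_one_iff_of_frame`).
[cite: Kottwitz1988, §2] [cite: Serre1980Trees, I.6] [cite: Tits1979, §3.5] [cite: Rogawski1990, §4.9] -/
theorem natCard_fixedBy_special_eq_one_add_mul_of_residually_two_congruent [ValuativeRel K] [(Valued.v : Valuation K ℤᵐ⁰).Compatible]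
    {σ : K →+* K} {ϖ : K} (hd : UnramifiedLocalConjDatum σ ϖ) (hσO : ∀ x : 𝒪[K], σ x ∈ 𝒪[K]) (σk : 𝓀[K] →+* 𝓀[K])
    (hσk : ∀ x : 𝒪[K], IsLocalRing.residue 𝒪[K] ⟨σ x, hσO x⟩ = σk (IsLocalRing.residue 𝒪[K] x))
    [Fintype 𝓀[K]] {q : ℕ} (hq : Fintype.card 𝓀[K] = q ^ 2) (hfrob : ∀ y, σk y = y ^ q)
    (g₁ : GL (Fin 3) K) (hg₁ : (g₁ : Matrix (Fin 3) (Fin 3) K) = Matrix.diagonal ![(1 : K), 1, ϖ])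
    (γ : ↥(unitaryGroupOfForm σ ((StdForm.antidiagonal 3).over K)))
    [Fintype (fixedBy (↥(unitaryGroupOfForm σ ((StdForm.antidiagonal 3).over K)) ⧸
      (glInt 3 K).subgroupOf (unitaryGroupOfForm σ ((StdForm.antidiagonal 3).over K))) γ)]
    (hK₁fin : (fixedBy (↥(unitaryGroupOfForm σ ((StdForm.antidiagonal 3).over K)) ⧸
      ((glInt 3 K).map (MulAut.conj g₁).toMonoidHom).subgroupOf (unitaryGroupOfForm σ ((StdForm.antidiagonal 3).over K))) γ).Finite)
    (horb : (Set.range fun n : ℕ => ((γ ^ n : ↥(unitaryGroupOfForm σ ((StdForm.antidiagonal 3).over K))) :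
      ↥(unitaryGroupOfForm σ ((StdForm.antidiagonal 3).over K)) ⧸ (glInt 3 K).subgroupOf (unitaryGroupOfForm σ ((StdForm.antidiagonal 3).over K)))).Finite)
    (r : ↥(unitaryGroupOfForm σ ((StdForm.antidiagonal 3).over K)) ⧸ (glInt 3 K).subgroupOf (unitaryGroupOfForm σ ((StdForm.antidiagonal 3).over K)) →
      ↥(unitaryGroupOfForm σ ((StdForm.antidiagonal 3).over K)))
    (hr : Function.RightInverse r QuotientGroup.mk)
    [∀ x : fixedBy (↥(unitaryGroupOfForm σ ((StdForm.antidiagonal 3).over K)) ⧸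
        (glInt 3 K).subgroupOf (unitaryGroupOfForm σ ((StdForm.antidiagonal 3).over K))) γ,
      Finite (fixedBy (↥((glInt 3 K).subgroupOf (unitaryGroupOfForm σ ((StdForm.antidiagonal 3).over K))) ⧸
        (((glInt 3 K).subgroupOf (unitaryGroupOfForm σ ((StdForm.antidiagonal 3).over K)) ⊓
          ((glInt 3 K).map (MulAut.conj g₁).toMonoidHom).subgroupOf (unitaryGroupOfForm σ ((StdForm.antidiagonal 3).over K))).subgroupOf
          ((glInt 3 K).subgroupOf (unitaryGroupOfForm σ ((StdForm.antidiagonal 3).over K)))))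
        (⟨(r x.1)⁻¹ * γ * r x.1, inv_mul_mul_mem_of_smul_eq r hr γ x.2⟩ :
          ↥((glInt 3 K).subgroupOf (unitaryGroupOfForm σ ((StdForm.antidiagonal 3).over K)))))]
    {c₁ c₂ : K} (hc₁ : Valued.v c₁ = 1) (hsep : Valued.v (c₁ - c₂) = 1)
    (hframe : ∀ x : fixedBy (↥(unitaryGroupOfForm σ ((StdForm.antidiagonal 3).over K)) ⧸
        (glInt 3 K).subgroupOf (unitaryGroupOfForm σ ((StdForm.antidiagonal 3).over K))) γ,
      ∃ P : GL (Fin 3) K, (∀ i j, Valued.v ((P : Matrix (Fin 3) (Fin 3) K) i j) ≤ 1) ∧ (∀ i j, Valued.v (((P⁻¹ : GL (Fin 3) K) : Matrix (Fin 3) (Fin 3) K) i j) ≤ 1) ∧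
        Valued.v ((((P⁻¹ : GL (Fin 3) K) : Matrix (Fin 3) (Fin 3) K) *
          (((((r x.1)⁻¹ * γ * r x.1 : ↥(unitaryGroupOfForm σ ((StdForm.antidiagonal 3).over K))) : GL (Fin 3) K) : Matrix (Fin 3) (Fin 3) K)) *
          (P : Matrix (Fin 3) (Fin 3) K)) 0 0 - c₁) < 1 ∧
        Valued.v ((((P⁻¹ : GL (Fin 3) K) : Matrix (Fin 3) (Fin 3) K) *
          (((((r x.1)⁻¹ * γ * r x.1 : ↥(unitaryGroupOfForm σ ((StdForm.antidiagonal 3).over K))) : GL (Fin 3) K) : Matrix (Fin 3) (Fin 3) K)) *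
          (P : Matrix (Fin 3) (Fin 3) K)) 1 1 - c₁) < 1 ∧
        Valued.v ((((P⁻¹ : GL (Fin 3) K) : Matrix (Fin 3) (Fin 3) K) *
          (((((r x.1)⁻¹ * γ * r x.1 : ↥(unitaryGroupOfForm σ ((StdForm.antidiagonal 3).over K))) : GL (Fin 3) K) : Matrix (Fin 3) (Fin 3) K)) *
          (P : Matrix (Fin 3) (Fin 3) K)) 2 2 - c₂) < 1 ∧
        (∀ i j : Fin 3, i ≠ j → (i, j) ≠ ((1 : Fin 3), (0 : Fin 3)) →
          Valued.v ((((P⁻¹ : GL (Fin 3) K) : Matrix (Fin 3) (Fin 3) K) *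
            (((((r x.1)⁻¹ * γ * r x.1 : ↥(unitaryGroupOfForm σ ((StdForm.antidiagonal 3).over K))) : GL (Fin 3) K) : Matrix (Fin 3) (Fin 3) K)) *
            (P : Matrix (Fin 3) (Fin 3) K)) i j) < 1) ∧
        Valued.v (B₀ σ 3 ((P : Matrix (Fin 3) (Fin 3) K).mulVec (Pi.single 2 1)) ((P : Matrix (Fin 3) (Fin 3) K).mulVec (Pi.single 2 1))) = 1 ∧
        Valued.v (B₀ σ 3 ((P : Matrix (Fin 3) (Fin 3) K).mulVec (Pi.single 1 1)) ((P : Matrix (Fin 3) (Fin 3) K).mulVec (Pi.single 1 1))) < 1 ∧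
        (Valued.v ((((P⁻¹ : GL (Fin 3) K) : Matrix (Fin 3) (Fin 3) K) *
            (((((r x.1)⁻¹ * γ * r x.1 : ↥(unitaryGroupOfForm σ ((StdForm.antidiagonal 3).over K))) : GL (Fin 3) K) : Matrix (Fin 3) (Fin 3) K)) *
            (P : Matrix (Fin 3) (Fin 3) K)) 1 0) < 1 →
          Valued.v (B₀ σ 3 ((P : Matrix (Fin 3) (Fin 3) K).mulVec (Pi.single 0 1)) ((P : Matrix (Fin 3) (Fin 3) K).mulVec (Pi.single 0 1))) < 1 ∧
          Valued.v (B₀ σ 3 ((P : Matrix (Fin 3) (Fin 3) K).mulVec (Pi.single 0 1)) ((P : Matrix (Fin 3) (Fin 3) K).mulVec (Pi.single 1 1))) = 1)) :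
    Nat.card (fixedBy (↥(unitaryGroupOfForm σ ((StdForm.antidiagonal 3).over K)) ⧸
        ((glInt 3 K).map (MulAut.conj g₁).toMonoidHom).subgroupOf (unitaryGroupOfForm σ ((StdForm.antidiagonal 3).over K))) γ) =
      1 + q * Nat.card {x : fixedBy (↥(unitaryGroupOfForm σ ((StdForm.antidiagonal 3).over K)) ⧸
            (glInt 3 K).subgroupOf (unitaryGroupOfForm σ ((StdForm.antidiagonal 3).over K))) γ //
          ∀ i j, Valued.v (((((((r x.1)⁻¹ * γ * r x.1 : ↥(unitaryGroupOfForm σ ((StdForm.antidiagonal 3).over K))) : GL (Fin 3) K) : Matrix (Fin 3) (Fin 3) K) -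
              c₁ • (1 : Matrix (Fin 3) (Fin 3) K)) *
            (((((r x.1)⁻¹ * γ * r x.1 : ↥(unitaryGroupOfForm σ ((StdForm.antidiagonal 3).over K))) : GL (Fin 3) K) : Matrix (Fin 3) (Fin 3) K) -
              c₂ • (1 : Matrix (Fin 3) (Fin 3) K))) i j) < 1} := by
  classical
  -- ★ FILE 1: `a₁ + a₀ = 1 + Σ_x s(x)`
  have h1 := natCard_fixedBy_special_add_eq_one_add_sum hd g₁ hg₁ γ hK₁fin horb r hr
  -- the local monodromies are in `K₀`
  have hkK₀ : ∀ x : fixedBy (↥(unitaryGroupOfForm σ ((StdForm.antidiagonal 3).over K)) ⧸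
      (glInt 3 K).subgroupOf (unitaryGroupOfForm σ ((StdForm.antidiagonal 3).over K))) γ,
      ((r x.1)⁻¹ * γ * r x.1 : ↥(unitaryGroupOfForm σ ((StdForm.antidiagonal 3).over K))) ∈ unitaryInt σ ((StdForm.antidiagonal 3).over K) := by
    intro x
    rw [unitaryInt_eq_glInt_subgroupOf]
    exact inv_mul_mul_mem_of_smul_eq r hr γ x.2
  -- the dichotomy `s(x) ∈ {q + 1, 1}` read by the frame
  have hsx : ∀ x : fixedBy (↥(unitaryGroupOfForm σ ((StdForm.antidiagonal 3).over K)) ⧸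
      (glInt 3 K).subgroupOf (unitaryGroupOfForm σ ((StdForm.antidiagonal 3).over K))) γ,
      Nat.card (fixedBy (↥((glInt 3 K).subgroupOf (unitaryGroupOfForm σ ((StdForm.antidiagonal 3).over K))) ⧸
        (((glInt 3 K).subgroupOf (unitaryGroupOfForm σ ((StdForm.antidiagonal 3).over K)) ⊓
          ((glInt 3 K).map (MulAut.conj g₁).toMonoidHom).subgroupOf (unitaryGroupOfForm σ ((StdForm.antidiagonal 3).over K))).subgroupOf
          ((glInt 3 K).subgroupOf (unitaryGroupOfForm σ ((StdForm.antidiagonal 3).over K)))))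
        (⟨(r x.1)⁻¹ * γ * r x.1, inv_mul_mul_mem_of_smul_eq r hr γ x.2⟩ :
          ↥((glInt 3 K).subgroupOf (unitaryGroupOfForm σ ((StdForm.antidiagonal 3).over K))))) =
      if ∀ i j, Valued.v (((((((r x.1)⁻¹ * γ * r x.1 : ↥(unitaryGroupOfForm σ ((StdForm.antidiagonal 3).over K))) : GL (Fin 3) K) : Matrix (Fin 3) (Fin 3) K) -
              c₁ • (1 : Matrix (Fin 3) (Fin 3) K)) *
            (((((r x.1)⁻¹ * γ * r x.1 : ↥(unitaryGroupOfForm σ ((StdForm.antidiagonal 3).over K))) : GL (Fin 3) K) : Matrix (Fin 3) (Fin 3) K) -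
              c₂ • (1 : Matrix (Fin 3) (Fin 3) K))) i j) < 1 then q + 1 else 1 := by
    intro x
    rw [natCard_fixedBy_star_eq_ncard_fixed_neighborSet_root hd g₁ hg₁ _ (inv_mul_mul_mem_of_smul_eq r hr γ x.2)]
    obtain ⟨P, hP, hP', h00, h11, h22, hoff, hp2, hp1, hhyp⟩ := hframe x
    have hkint := (mem_unitaryInt_iff.1 (hkK₀ x)).1
    have hiff := forall_v_sub_mul_sub_apply_lt_one_iff_of_frame hkint P hP hP' hc₁ hsep h00 h11 h22 hoff
    -- `|A₂₂ − c₁| = 1`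
    have h22' : Valued.v ((((P⁻¹ : GL (Fin 3) K) : Matrix (Fin 3) (Fin 3) K) *
        (((((r x.1)⁻¹ * γ * r x.1 : ↥(unitaryGroupOfForm σ ((StdForm.antidiagonal 3).over K))) : GL (Fin 3) K) : Matrix (Fin 3) (Fin 3) K)) *
        (P : Matrix (Fin 3) (Fin 3) K)) 2 2 - c₁) = 1 := by
      rw [show ∀ a : K, a - c₁ = -(c₁ - c₂) + (a - c₂) from fun a => by ring,
        Valuation.map_add_eq_of_lt_left _ (by rw [Valuation.map_neg, hsep]; exact h22), Valuation.map_neg, hsep]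
    split_ifs with hss
    · -- residually semisimple: ★ 3c-A
      have h10 := hiff.1 hss
      obtain ⟨hp00, hp01⟩ := hhyp h10
      refine ncard_fixed_neighborSet_root_eq_residualIso_of_residually_plane_scalar hd hσO σk hσk hq hfrob _ (hkK₀ x) P hP hP' hc₁ h00 h11 h22'
        (fun i j hij => ?_) hp00 hp1 hp01 hp2
      by_cases h : (i, j) = ((1 : Fin 3), (0 : Fin 3))
      · simp only [Prod.mk.injEq] at h
        rw [h.1, h.2]; exact h10
      · exact hoff i j hij h
    · -- residually a non-trivial `c₁`-unipotent on the plane: ★ 3c-B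
      have h10 : Valued.v ((((P⁻¹ : GL (Fin 3) K) : Matrix (Fin 3) (Fin 3) K) *
          (((((r x.1)⁻¹ * γ * r x.1 : ↥(unitaryGroupOfForm σ ((StdForm.antidiagonal 3).over K))) : GL (Fin 3) K) : Matrix (Fin 3) (Fin 3) K)) *
          (P : Matrix (Fin 3) (Fin 3) K)) 1 0) = 1 := by
        refine le_antisymm ?_ (not_lt.1 fun h => hss (hiff.2 h))
        rw [Matrix.mul_apply]
        refine Valuation.map_sum_le _ fun a _ => ?_
        rw [map_mul]
        refine mul_le_one' ?_ (hP a 0)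
        rw [Matrix.mul_apply]
        refine Valuation.map_sum_le _ fun b _ => ?_
        rw [map_mul]; exact mul_le_one' (hP' 1 b) (hkint b a)
      exact ncard_fixed_neighborSet_root_eq_one_of_residually_plane_unipotent hd _ (hkK₀ x) P hP hP' hc₁ h00 h11 h22' h10 hoff hp1 hp2
  -- assemble: `Σ_x s(x) = (q+1)·m + (a₀ − m)`
  rw [Finset.sum_congr rfl fun x _ => hsx x, Finset.sum_ite, Finset.sum_const, Finset.sum_const, smul_eq_mul, smul_eq_mul, mul_one] at h1
  have hcard := Finset.card_filter_add_card_filter_not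
    (s := (Finset.univ : Finset (fixedBy (↥(unitaryGroupOfForm σ ((StdForm.antidiagonal 3).over K)) ⧸
      (glInt 3 K).subgroupOf (unitaryGroupOfForm σ ((StdForm.antidiagonal 3).over K))) γ)))
    (fun x => ∀ i j, Valued.v (((((((r x.1)⁻¹ * γ * r x.1 : ↥(unitaryGroupOfForm σ ((StdForm.antidiagonal 3).over K))) : GL (Fin 3) K) :
        Matrix (Fin 3) (Fin 3) K) - c₁ • (1 : Matrix (Fin 3) (Fin 3) K)) *
      (((((r x.1)⁻¹ * γ * r x.1 : ↥(unitaryGroupOfForm σ ((StdForm.antidiagonal 3).over K))) : GL (Fin 3) K) : Matrix (Fin 3) (Fin 3) K) -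
        c₂ • (1 : Matrix (Fin 3) (Fin 3) K))) i j) < 1)
  rw [Finset.card_univ, ← Nat.card_eq_fintype_card] at hcard
  rw [Nat.card_eq_fintype_card (α := {x : fixedBy (↥(unitaryGroupOfForm σ ((StdForm.antidiagonal 3).over K)) ⧸
      (glInt 3 K).subgroupOf (unitaryGroupOfForm σ ((StdForm.antidiagonal 3).over K))) γ // _}), Fintype.card_subtype]
  linarith [hcard, h1]

end Summit.HodgeConjecture.HodgeConjecture.R90.S6

end
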